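/-
Copyright: cell pub-balaban-gaps (YM BLITZ Y1, track G1), seat g1-p2 GEN 7 (unit `pub-balaban-gaps-g1-p2`).  Row (D4) NODE O,
OBJECT ∕ MECHANISM level: the PRODUCER of `D4WalkBlockDerivative`'s input shape — RELATIVE DERIVATIVE LETTERS for DOMAIN-LOCALISED
seed families (print's `h_□G′_□h_□` of (3.87) with Cor. 3.6's local (3.42) value AND derivative entries) — and the one-scale END of
[B9] Sect. B + C in block currency with derivative letters: local letters ⟹ glued `G′₀(1 − R)⁻¹` ⟹ `G′(U′U)`-shaped
`G′(1 − V′G′)⁻¹`, every constant an explicit k-free function of the letters.  HONEST FRAMING: bookkeeping over hypothesis SHAPES at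
MODEL generality; nothing of Bałaban's `G′_□`, `h_□`, `∇_U`, `V′(A)` constructed or asserted; (D4) NOT discharged (instance 0∕1);
NOT BetaPertH, NOT continuum, NOT Clay.
-/
import Summits.QuantumFields.BalabanUV.Gaps.D4WalkBlockDerivative
import Summits.QuantumFields.BalabanUV.Gaps.D4WalkBlockLocal

/-!
# `Gaps.D4WalkBlockDerivativeLocal` — derivative letters for domain-localised seeds and the one-scale Sect. B + C END with
# derivative letters (cell pub-balaban-gaps, seat g1-p2 gen 7)

HONEST DEPENDENCY (cell pub-balaban, verbatim): continuum YM on T⁴ ⇐ BetaPertH ∧ nine spine estimates (0/9 proved);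
BetaPertH ⇐ (D1) ∧ (D4) ∧ CAP+tail.

[B9] (3.87) `G′₀ = Σ_□ h_□G′_□h_□`, (3.88)–(3.90) `G′ = G′₀(I − R′)⁻¹`, Cor. 3.6 p. 408 («Theorems 3.1–3.3 hold for the operators
G′_□(U), …» — the LOCAL operators carry the value AND derivative entries of (3.42)), Sect. B (3.60)–(3.65) pp. 402–403.
`D4WalkBlockDerivative` (55) types the perturbation step with RELATIVE DERIVATIVE LETTERS `‖∇_μT_ω‖_{y,y′} ≤ B_μ·A_ωe^{−ρD_ω}`
as INPUT; THIS FILE produces that input from LOCAL letters and composes the one-scale END: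
* §1 `lmulTerms`: the datum `b ↦ ∇·F_b(u)` (left-multiplied coefficients, same domains ∕ anchors ∕ σ-sets), `term_lmulTerms`,
  `dist_lmulTerms`; `isDomainLocalB_lmulTerms`: if the blocks of `∇·F_b(u)` vanish off `dom b × dom b` (domains one collar larger than the
  supports — an instance choice) and are `≤ B·λ`, the companion datum is block-local with bound `B·λ`.
* §2 **`derivLetters_domainLocal`**: hence the terms of `D4WalkBlockLocal.blockWalkExpansion_domainLocal hL` carry the RELATIVE
  derivative letter `B` EXACTLY (same amplitude `λe^{κ₁m_J}e^{2ρr}`, same one-point distance) — the shape 55 consumes.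
* §3 **`blockWalkExpansion_localGlue_deriv`** — (3.90) WITH DERIVATIVE LETTERS: a block-local SEED datum `L_S` (value `λ_S`,
  derivative companions `B_μ`) and a block-local STEP datum `L_R` (value `λ_R` — print's `K(h_□)G′_□h_□`, `λ_R = O(M⁻¹)` by (3.89))
  on one geometry `(r, m_J, n_D)`, cube row sum `(μ, c_μ)`, rates `0 ≤ μ`, `2μ ≤ ε`, `2μ ≤ κ`, `κ + μ ≤ ρ − ε`, and the MARGIN
  `c_μ(c_μ·1·(1·K̄_R)c_μ)c_μ < 1` with `K̄_R = λ_Re^{κ₁m_J}e^{2ρr}e^{μr}n_Dc_μ` («M sufficiently large») ⟹ `S(1 − R)⁻¹` is a block walk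
  expansion at `(ε − 2μ, κ − 2μ, c_μK̄_S(1·(1−q)⁻¹)c_μ, ρ − 2μ)` WITH the relative derivative letters `B_μ` and dominating distances
  (= 55's `blockWalkExpansion_perturb` with `P := R`).
* §4 **`blockWalkExpansion_localSectB`** — THE ONE-SCALE SECT. B + C END: §3 followed by 55's `blockWalkExpansion_perturb_of_derivLetters`
  for a perturbation `V(u)` with the (3.61)-shape domination letter `(α₀, α_μ)`: `S(1−R)⁻¹(1 − V·S(1−R)⁻¹)⁻¹` is a block walk expansion
  at `(ε − 4μ, κ − 4μ, …, ρ − 4μ)` with the relative derivative letters `B_μ`, BOTH margins displayed — the second reads «α₁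
  sufficiently small» against `(c_μ, K̄, B_μ)` only; `localSectB_kernel_eq_inv`: with `Δ′S = 1 − R` ((3.88)) and the two units, the
  kernel at `s ≡ 1` is `(Δ′ − V)⁻¹` (= `G′(U′U)` by (3.60) ∕ (3.64)).
WHAT IT IS NOT.  The instance (Bałaban's `h_□`, `G′_□(U)` with Cor. 3.6's letters, `K(h_□)`, `∇_U`, `V′(A)`); the s-decorated ∕
Lipschitz-partition refinements of the seat's files 38–47 (their ENDs are ∃-packaged without derivative clauses — re-threading them is a
separate rung); (D4) instance 0∕1; words of row (D4) UNCHANGED.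

References: T. Bałaban, Comm. Math. Phys. **99** (1985) 389–434 [B9]: Thm 3.1 (3.42) p. 397, (3.60)–(3.65) pp. 402–403, Cor. 3.6
p. 408, (3.87)–(3.90) p. 409, (3.92)–(3.94) p. 410, Thm 3.10 (3.107)–(3.108) p. 416; Comm. Math. Phys. **116** (1988) 1–22 [II],
(1.11) p. 5, p. 13, p. 15; Comm. Math. Phys. **96** (1984) 223–250 [4], Prop. 2.2 (2.67) p. 234.
-/

noncomputable section

namespace Summit.QuantumFields.BalabanUV.Gaps.D4WalkBlockDerivativeLocal

open Metric Set Finset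
open Literature.MathematicalPhysics.QuantumFieldTheory.Balaban1983to89
open Literature.MathematicalPhysics.QuantumFieldTheory.Balaban1983to89.B9SectDWalk (DomBy)
open Literature.MathematicalPhysics.QuantumFieldTheory.Balaban1983to89.B9Thm34Ext (toB6)
open Literature.MathematicalPhysics.QuantumFieldTheory.Balaban1983to89.B9Thm37GlueTorus (torusGeom tdist1)
open Literature.MathematicalPhysics.QuantumFieldTheory.Balaban1983to89.TreeLengthTorus (TPt)
open Literature.MathematicalPhysics.QuantumFieldTheory.Balaban1983to89.B5TorusCover (UT)
open Literature.MathematicalPhysics.QuantumFieldTheory.Balaban1983to89.B11SectG (RowSum)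
open Literature.MathematicalPhysics.QuantumFieldTheory.Balaban1983to89.B13DomainKernelWalks (DomainTerms)
open Summit.QuantumFields.BalabanUV.Gaps.D4WalkBlock (blockNorm blockNorm_smul_le BlockWalkExpansion)
open Summit.QuantumFields.BalabanUV.Gaps.D4WalkBlockLocal (IsDomainLocalB blockNorm_term_le blockWalkExpansion_domainLocal)
open Summit.QuantumFields.BalabanUV.Gaps.D4WalkBlockDerivative
  (blockWalkExpansion_perturb blockWalkExpansion_perturb_of_derivLetters perturb_kernel_eq_inv)

variable {d N' : ℕ} {ν : ℕ} {K : Fin ν → ℕ} [∀ i, NeZero (K i)]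
variable {p n q : Type} [Fintype p] [Fintype n] [Fintype q]
variable {E : Type*} [NormedAddCommGroup E] [NormedSpace ℂ E]

/-! ## §1. The left-multiplied datum `b ↦ ∇·F_b(u)` and its block locality -/

/-- The datum with coefficients left-multiplied by a fixed matrix `∇ : Matrix q p ℂ` — same index, domains, anchors, σ-sets
(the DERIVATIVE COMPANION of a domain-localised family). [cite: Balaban1985BackgroundPropagators, Thm 3.1 (3.42) p.397, (3.87) p.409] -/
def lmulTerms (L : DomainTerms d N' ν K p n E) (Dop : Matrix q p ℂ) : DomainTerms d N' ν K q n E where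
  B := L.B
  dom := L.dom
  anchor := L.anchor
  J := L.J
  op b u := Dop * L.op b u

variable (L : DomainTerms d N' ν K p n E) (Dop : Matrix q p ℂ)

omit [Fintype n] [Fintype q] in
/-- The companion's terms are `∇·T_b(σ,u)`. -/
theorem term_lmulTerms (b : L.B) (σ : TPt d N' → ℂ) (u : E) : (lmulTerms L Dop).term b σ u = Dop * L.term b σ u := by
  show (∏ j ∈ L.J b, σ j) • (Dop * L.op b u) = Dop * ((∏ j ∈ L.J b, σ j) • L.op b u)
  rw [Matrix.mul_smul]

omit [Fintype n] [Fintype q] in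
/-- The companion's one-point distances are the datum's. -/
theorem dist_lmulTerms (X : Finset (UT K)) : (lmulTerms L Dop).dist X = L.dist X := rfl

variable {L Dop}
variable {c : B13.Consts} {cub : p → UT K} {cubn : n → UT K} {cubq : q → UT K} {X : Finset (UT K)} {R lam r : ℝ} {mJ nD : ℕ}

/-- **BLOCK LOCALITY OF THE DERIVATIVE COMPANION**: if the blocks of `∇·F_b(u)` vanish off `dom b × dom b` and are `≤ B·λ` on the
ball (print: Cor. 3.6's derivative entries of (3.42) for the local operators; the domains are chosen one collar larger than the
supports), the companion datum is block-local with bound `B·λ` on the same geometry. [cite: Balaban1985BackgroundPropagators, Thm 3.1 (3.42) p.397, Cor. 3.6 p.408, (3.87) p.409] -/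
theorem isDomainLocalB_lmulTerms (hL : IsDomainLocalB L c cub cubn X R lam r mJ nD) {B : ℝ}
    (hsupp : ∀ b u y y', blockNorm cubq cubn (Dop * L.op b u) y y' ≠ 0 → y ∈ L.dom b ∧ y' ∈ L.dom b)
    (hbd : ∀ b, ∀ u ∈ ball (0 : E) R, ∀ y y', blockNorm cubq cubn (Dop * L.op b u) y y' ≤ B * lam) :
    IsDomainLocalB (lmulTerms L Dop) c cubq cubn X R (B * lam) r mJ nD where
  hanchor := hL.hanchor
  hsuppB := hsupp
  han b i j := by
    show DifferentiableOn ℂ (fun u => (Dop * L.op b u) i j) (ball (0 : E) R)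
    have e : (fun u => (Dop * L.op b u) i j) = fun u => ∑ k, Dop i k * L.op b u k j := funext fun u => Matrix.mul_apply
    rw [e]
    exact DifferentiableOn.fun_sum fun k _ => (hL.han b k j).const_mul _
  hbdB := hbd
  hdiam := hL.hdiam
  hJ := hL.hJ
  hX := hL.hX
  hmult := hL.hmult

/-! ## §2. Relative derivative letters for domain-localised seeds -/

/-- **DERIVATIVE LETTERS FOR A DOMAIN-LOCALISED FAMILY — THE RELATIVE FACTOR IS EXACTLY `B`**: under `IsDomainLocalB` (`λ, κ₁ ≥ 0`,
`ρ ≥ 0`) and the two companion letters of `isDomainLocalB_lmulTerms` (`B ≥ 0`), every term satisfies `‖∇·T_b(σ,u)‖_{y,y′} ≤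
B·(λe^{κ₁m_J}e^{2ρr})·e^{−ρD_b(y,y′)}` — the amplitude and distance of `D4WalkBlockLocal.blockWalkExpansion_domainLocal hL`, so this IS
the relative derivative letter `D4WalkBlockDerivative.blockWalkExpansion_perturb` consumes. [cite: Balaban1985BackgroundPropagators, Thm 3.1 (3.42) p.397, Cor. 3.6 p.408, (3.87) p.409, (3.108) p.416; Balaban1988RG2Cluster, (1.11) p.5] -/
theorem derivLetters_domainLocal (hL : IsDomainLocalB L c cub cubn X R lam r mJ nD) (hκ₁ : 0 ≤ c.κ₁) (hlam : 0 ≤ lam)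
    {ρ : ℝ} (hρ : 0 ≤ ρ) {B : ℝ} (hB : 0 ≤ B)
    (hsupp : ∀ b u y y', blockNorm cubq cubn (Dop * L.op b u) y y' ≠ 0 → y ∈ L.dom b ∧ y' ∈ L.dom b)
    (hbd : ∀ b, ∀ u ∈ ball (0 : E) R, ∀ y y', blockNorm cubq cubn (Dop * L.op b u) y y' ≤ B * lam) :
    ∀ b, ∀ σ : TPt d N' → ℂ, (∀ j, ‖σ j‖ ≤ Real.exp c.κ₁) → ∀ u ∈ ball (0 : E) R, ∀ y y',
      blockNorm cubq cubn (Dop * L.term b σ u) y y' ≤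
        B * ((lam * Real.exp (c.κ₁ * mJ) * Real.exp (2 * ρ * r)) * Real.exp (-(ρ * L.dist X b y y'))) := by
  intro b σ hσ u hu y y'
  have h := blockNorm_term_le (isDomainLocalB_lmulTerms hL hsupp hbd) hκ₁ (mul_nonneg hB hlam) hρ b σ hσ u hu y y'
  rw [term_lmulTerms] at h
  calc _ ≤ _ := h
    _ = _ := by rw [dist_lmulTerms]; ring

/-! ## §3. (3.90) with derivative letters: local seed + local step ⟹ glued expansion carrying `B_μ` -/

section Glue

variable [DecidableEq n] {cubn : n → UT K}
variable {LS LR : DomainTerms d N' ν K n n E} {lamS lamR : ℝ}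
variable {ι : Type*} {Dop : ι → Matrix p n ℂ} {B : ι → ℝ}
variable {ρ ε κ μ cμ : ℝ}

/-- **(3.90) WITH DERIVATIVE LETTERS.**  A block-local SEED `L_S` (value `λ_S`; derivative companions: for each `μ` the blocks of
`∇_μF_b(u)` vanish off `dom b × dom b` and are `≤ B_μλ_S`) and a block-local STEP `L_R` (value `λ_R`) on one geometry
`(r, m_J, n_D)` and σ-region; `κ₁, λ, B ≥ 0`; cube row sum `(μ, c_μ)`; rates `0 ≤ μ`, `2μ ≤ ε`, `2μ ≤ κ`, `κ + μ ≤ ρ − ε`; MARGIN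
`q = c_μ(c_μ·1·(1·K̄_R)c_μ)c_μ < 1`, `K̄_R = λ_Re^{κ₁m_J}e^{2ρr}e^{μr}n_Dc_μ` («M sufficiently large»: print's `λ_R = O(M⁻¹)`, (3.89)) ⟹
`S(1 − R)⁻¹` is a block walk expansion at `(ε − 2μ, κ − 2μ)`, walk rate `ρ − 2μ`, constant `c_μK̄_S(1·(1−q)⁻¹)c_μ`, with dominating
distances and the relative derivative letters `B_μ` (§2 → 55's `blockWalkExpansion_perturb` with `P := R`).
[cite: Balaban1985BackgroundPropagators, (3.87)–(3.90) p.409, Cor. 3.6 p.408, Thm 3.1 (3.42) p.397, Thm 3.10 (3.107)–(3.108) p.416; Balaban1988RG2Cluster, (1.11) p.5, p.13, p.15] -/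
theorem blockWalkExpansion_localGlue_deriv
    (hS : IsDomainLocalB LS c cubn cubn X R lamS r mJ nD) (hRl : IsDomainLocalB LR c cubn cubn X R lamR r mJ nD)
    (hκ₁ : 0 ≤ c.κ₁) (hlamS : 0 ≤ lamS) (hlamR : 0 ≤ lamR) (hB : ∀ μ', 0 ≤ B μ')
    (hDsupp : ∀ μ' b u y y', blockNorm cub cubn (Dop μ' * LS.op b u) y y' ≠ 0 → y ∈ LS.dom b ∧ y' ∈ LS.dom b)
    (hDbd : ∀ μ' b, ∀ u ∈ ball (0 : E) R, ∀ y y', blockNorm cub cubn (Dop μ' * LS.op b u) y y' ≤ B μ' * lamS)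
    (hρ : 0 ≤ ρ) (hμ : 0 ≤ μ) (hμε : 2 * μ ≤ ε) (hμκ : 2 * μ ≤ κ) (hwin : κ + μ ≤ ρ - ε) (hcμ : 0 ≤ cμ)
    (hrow : RowSum (toB6 (torusGeom K 0 0 0) 0 True) μ cμ)
    (hq : cμ * (cμ * 1 * (1 * ((lamR * Real.exp (c.κ₁ * mJ) * Real.exp (2 * ρ * r)) * Real.exp (μ * r) * (nD * cμ))) * cμ) *
      cμ < 1) :
    ∃ (W : Type) (T : W → (TPt d N' → ℂ) → E → Matrix n n ℂ) (SX' : Set W) (A' : W → ℝ) (D' : W → UT K → UT K → ℝ),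
      BlockWalkExpansion c cubn cubn (fun σ u => LS.kernel σ u * (1 - LR.kernel σ u)⁻¹) X R (ε - 2 * μ) (κ - 2 * μ)
        (cμ * ((lamS * Real.exp (c.κ₁ * mJ) * Real.exp (2 * ρ * r)) * Real.exp (μ * r) * (nD * cμ)) *
          (1 * (1 - cμ * (cμ * 1 * (1 * ((lamR * Real.exp (c.κ₁ * mJ) * Real.exp (2 * ρ * r)) * Real.exp (μ * r) *
            (nD * cμ))) * cμ) * cμ)⁻¹) * cμ) T SX' A' D' (ρ - 2 * μ) ∧
      (∀ μ' ω, ∀ σ : TPt d N' → ℂ, (∀ j, ‖σ j‖ ≤ Real.exp c.κ₁) → ∀ u ∈ ball (0 : E) R, ∀ y y',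
        blockNorm cub cubn (Dop μ' * T ω σ u) y y' ≤ B μ' * (A' ω * Real.exp (-((ρ - 2 * μ) * D' ω y y')))) ∧
      ∀ ω, DomBy (toB6 (torusGeom K 0 0 0) 0 True) (D' ω) := by
  have hκ : 0 ≤ κ := by linarith
  have hSw := blockWalkExpansion_domainLocal hS hκ₁ hlamS (ε := ε) hρ hκ hμ hwin hrow
  have hRw := blockWalkExpansion_domainLocal hRl hκ₁ hlamR (ε := ε) hρ hκ hμ hwin hrow
  exact blockWalkExpansion_perturb hSw (fun b => LS.domBy_dist X b) hB
    (fun μ' b σ hσ u hu y y' => derivLetters_domainLocal hS hκ₁ hlamS hρ (hB μ') (hDsupp μ') (hDbd μ') b σ hσ u hu y y')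
    hRw (fun b => LR.domBy_dist X b) hμ hμε hμκ hwin (by positivity) (by positivity) hcμ hrow hq

/-! ## §4. THE ONE-SCALE SECT. B + C END with derivative letters, both margins displayed; the kernel at `s ≡ 1` -/

variable [Fintype ι] {V : E → Matrix n n ℂ} {α₀ : ℝ} {α : ι → ℝ}

/-- **THE ONE-SCALE SECT. B + C END IN BLOCK CURRENCY WITH DERIVATIVE LETTERS.**  Data of `blockWalkExpansion_localGlue_deriv` with
`4μ ≤ ε`, `4μ ≤ κ`, plus a σ-independent entrywise-holomorphic perturbation `V(u)` (print: `V′(A)`) with the (3.61)-shape domination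
letter `‖V(u)S‖_{y,y′} ≤ α₀‖S‖_{y,y′} + Σ_μ α_μ‖∇_μS‖_{y,y′}` (`α ≥ 0`); with `K̄_R`, `q` as there, `K̄′ = c_μK̄_S(1·(1−q)⁻¹)c_μ` and the
SECOND MARGIN `q′ = c_μ(c_μ·1·(1·((α₀ + Σ_μ α_μB_μ)K̄′))c_μ)c_μ < 1` («α₁ sufficiently small» against `(c_μ, K̄′, B_μ)` only) ⟹ with
`G′ := S(1 − R)⁻¹`, the family `G′(1 − VG′)⁻¹` is a block walk expansion at `(ε − 4μ, κ − 4μ)`, walk rate `ρ − 4μ`, constant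
`c_μK̄′(1·(1−q′)⁻¹)c_μ`, with dominating distances and the relative derivative letters `B_μ` — from LOCAL letters only, every constant
an explicit function of `(λ_S, λ_R, B_μ, α, r, m_J, n_D, c_μ, κ₁, rates)`: k-UNIFORM when these are.
[cite: Balaban1985BackgroundPropagators, (3.87)–(3.90) p.409, (3.60)–(3.65) pp.402–403, Cor. 3.5 p.407, Cor. 3.6 p.408, Thm 3.4 p.400, Thm 3.1 (3.42) p.397, (3.107)–(3.108) p.416; Balaban1988RG2Cluster, (1.11) p.5, p.13, p.15] -/
theorem blockWalkExpansion_localSectB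
    (hS : IsDomainLocalB LS c cubn cubn X R lamS r mJ nD) (hRl : IsDomainLocalB LR c cubn cubn X R lamR r mJ nD)
    (hκ₁ : 0 ≤ c.κ₁) (hlamS : 0 ≤ lamS) (hlamR : 0 ≤ lamR) (hB : ∀ μ', 0 ≤ B μ')
    (hDsupp : ∀ μ' b u y y', blockNorm cub cubn (Dop μ' * LS.op b u) y y' ≠ 0 → y ∈ LS.dom b ∧ y' ∈ LS.dom b)
    (hDbd : ∀ μ' b, ∀ u ∈ ball (0 : E) R, ∀ y y', blockNorm cub cubn (Dop μ' * LS.op b u) y y' ≤ B μ' * lamS)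
    (hVan : ∀ i k, DifferentiableOn ℂ (fun u => V u i k) (ball (0 : E) R))
    (hα₀ : 0 ≤ α₀) (hα : ∀ μ', 0 ≤ α μ')
    (hV : ∀ u ∈ ball (0 : E) R, ∀ S y y', blockNorm cubn cubn (V u * S) y y' ≤
      α₀ * blockNorm cubn cubn S y y' + ∑ μ', α μ' * blockNorm cub cubn (Dop μ' * S) y y')
    (hρ : 0 ≤ ρ) (hμ : 0 ≤ μ) (hμε : 4 * μ ≤ ε) (hμκ : 4 * μ ≤ κ) (hwin : κ + μ ≤ ρ - ε) (hcμ : 0 ≤ cμ)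
    (hrow : RowSum (toB6 (torusGeom K 0 0 0) 0 True) μ cμ)
    (hq : cμ * (cμ * 1 * (1 * ((lamR * Real.exp (c.κ₁ * mJ) * Real.exp (2 * ρ * r)) * Real.exp (μ * r) * (nD * cμ))) * cμ) *
      cμ < 1)
    (hq' : cμ * (cμ * 1 * (1 * ((α₀ + ∑ μ', α μ' * B μ') *
      (cμ * ((lamS * Real.exp (c.κ₁ * mJ) * Real.exp (2 * ρ * r)) * Real.exp (μ * r) * (nD * cμ)) *
        (1 * (1 - cμ * (cμ * 1 * (1 * ((lamR * Real.exp (c.κ₁ * mJ) * Real.exp (2 * ρ * r)) * Real.exp (μ * r) *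
          (nD * cμ))) * cμ) * cμ)⁻¹) * cμ))) * cμ) * cμ < 1) :
    ∃ (W : Type) (T : W → (TPt d N' → ℂ) → E → Matrix n n ℂ) (SX' : Set W) (A' : W → ℝ) (D' : W → UT K → UT K → ℝ),
      BlockWalkExpansion c cubn cubn
        (fun σ u => (LS.kernel σ u * (1 - LR.kernel σ u)⁻¹) * (1 - V u * (LS.kernel σ u * (1 - LR.kernel σ u)⁻¹))⁻¹) X R
        (ε - 2 * μ - 2 * μ) (κ - 2 * μ - 2 * μ)
        (cμ * (cμ * ((lamS * Real.exp (c.κ₁ * mJ) * Real.exp (2 * ρ * r)) * Real.exp (μ * r) * (nD * cμ)) *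
          (1 * (1 - cμ * (cμ * 1 * (1 * ((lamR * Real.exp (c.κ₁ * mJ) * Real.exp (2 * ρ * r)) * Real.exp (μ * r) *
            (nD * cμ))) * cμ) * cμ)⁻¹) * cμ) *
          (1 * (1 - cμ * (cμ * 1 * (1 * ((α₀ + ∑ μ', α μ' * B μ') *
            (cμ * ((lamS * Real.exp (c.κ₁ * mJ) * Real.exp (2 * ρ * r)) * Real.exp (μ * r) * (nD * cμ)) *
              (1 * (1 - cμ * (cμ * 1 * (1 * ((lamR * Real.exp (c.κ₁ * mJ) * Real.exp (2 * ρ * r)) * Real.exp (μ * r) *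
                (nD * cμ))) * cμ) * cμ)⁻¹) * cμ))) * cμ) * cμ)⁻¹) * cμ)
        T SX' A' D' (ρ - 2 * μ - 2 * μ) ∧
      (∀ μ' ω, ∀ σ : TPt d N' → ℂ, (∀ j, ‖σ j‖ ≤ Real.exp c.κ₁) → ∀ u ∈ ball (0 : E) R, ∀ y y',
        blockNorm cub cubn (Dop μ' * T ω σ u) y y' ≤ B μ' * (A' ω * Real.exp (-((ρ - 2 * μ - 2 * μ) * D' ω y y')))) ∧
      ∀ ω, DomBy (toB6 (torusGeom K 0 0 0) 0 True) (D' ω) := by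
  obtain ⟨W₁, T₁, SX₁, A₁, D₁, hG, hGD, hGdom⟩ := blockWalkExpansion_localGlue_deriv (cub := cub) (Dop := Dop) hS hRl hκ₁ hlamS
    hlamR hB hDsupp hDbd hρ hμ (by linarith) (by linarith) hwin hcμ hrow hq
  have hq1 : 0 < 1 - cμ * (cμ * 1 * (1 * ((lamR * Real.exp (c.κ₁ * mJ) * Real.exp (2 * ρ * r)) * Real.exp (μ * r) *
      (nD * cμ))) * cμ) * cμ := by linarith
  exact blockWalkExpansion_perturb_of_derivLetters hG hGdom hB hGD hVan hα₀ hα hV hμ (by linarith) (by linarith) (by linarith)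
    (by positivity) hcμ hrow hq'

omit [Fintype ι] in
/-- **THE KERNEL AT `s ≡ 1`**: `Δ′S = 1 − R` ((3.88): `Δ′_aG′₀ = I − R′`) and the two units ⟹ `S(1−R)⁻¹(1 − V·S(1−R)⁻¹)⁻¹ = (Δ′ − V)⁻¹`
— `G′(U′U)` for `Δ′ = Δ′_a(U)`, `V = V′(A)` by (3.60) ∕ (3.64). [cite: Balaban1985BackgroundPropagators, (3.88)–(3.90) p.409, (3.60)–(3.64) p.402] -/
theorem localSectB_kernel_eq_inv (Δ S Rm Vm : Matrix n n ℂ) (h388 : Δ * S = 1 - Rm) (hR : IsUnit (1 - Rm).det)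
    (hV : IsUnit (1 - Vm * (S * (1 - Rm)⁻¹)).det) :
    (S * (1 - Rm)⁻¹) * (1 - Vm * (S * (1 - Rm)⁻¹))⁻¹ = (Δ - Vm)⁻¹ :=
  perturb_kernel_eq_inv Δ (S * (1 - Rm)⁻¹) Vm (by rw [← Matrix.mul_assoc, h388, Matrix.mul_nonsing_inv _ hR]) hV

end Glue

end Summit.QuantumFields.BalabanUV.Gaps.D4WalkBlockDerivativeLocal

end
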